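import Summits.QuantumFields.YangMills.Theorems.BalabanUVNodesN15TwoSpacingGluingNeumannKnitEntryTwoDefect
import Summits.QuantumFields.YangMills.Theorems.BalabanUVNodesN15TwoSpacingGluingRecordKnitEntryTwo
import HarnessLib

/-!
# THE GLUING STEP AT TWO LATTICE SPACINGS, LXIX: THE TWO-GRID η-DEFECT OF THE «G∇*» ENTRY OF THE RECORD COVER's PARAMETRIX — `𝔇(G̃′∇*′_ν, G̃∇*_ν) ≤ D·(L^K)^{−1∕(8(d+1))}·e^{−δ|y−y′|_T}`,
# VOLUME FREE (dag-n15-c g14, FILE 112 = 90R; N15 = NE2, s1 «background-layer OPERATOR ingredient»)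

Cell `pub-ymgap`, seat `pub-ymgap-dag-n15-c` (R134 (a); HUMAN RULING D-0062), generation 14.  `bears_on: R4∕N15 · K3⁸ SpineGivenEndpointR13SepCoPHV (stmt-QuantumFields-27366)`.
Filed `--supports stmt-QuantumFields-27366 --as helper` — COUNT-NEUTRAL.  Theorems only (0 `def`, 0 `sorry`).  Imports BY NAME FILE 90 `…NeumannKnitEntryTwoDefect` (`entryTwoDefectConst_le`;
through it FILE 83 `hasMaj_idef_parametrix_comp_cut`, FILE 89 `coverH_shift_support`, FILE 84 `abs_coverH_shift_fine_sub_le`, FILE 64∕65 fits, FILE 67 letters, FILE 72, FILE 74, `rpow_sixteenth_facts`)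
and FILE 111 `…RecordKnitEntryTwo` (FILE 73's cover; programme P: P-IIb `hasMaj_chiCube_liftCubeG`, P-IId `hasMaj_chiCube_liftCubeG_fine`, P-IIj `chiCube_liftCubeG_comp_divAdj_mulOp` ∕
`hasMaj_transplant_gDivAdj_pair` ∕ `hasMaj_idef_transplant_gDivAdj`, P-IIc `hasMaj_idef_chiCube_liftCubeG`, `mem_cubeW`); nothing in the tree is modified.

WHAT.  ★★★ **`hasMaj_idef_parametrix_divAdj_knitR`** — the record twin of FILE 90 `hasMaj_idef_parametrix_divAdj_knit`: for `d ≥ 1`, odd `L ≥ 3`, `a > 0` there are `δ, D > 0` such that for all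
`s`, `m_T ≥ s + 1`, `K ≥ 1` (`4 ≤ L^K`), `r`, `ν`, on `MP (paramsOf d L m_T K hL)` with FILE 73's cover at the two spacings `L^{−K}` ⊃ `L^{−(K+r)}`:
  `𝔇(G̃′∘∇*′_ν, G̃∘∇*_ν) ≤ D·(L^K)^{−1∕(8(d+1))}·e^{−δ|y−y′|_T}`
— row 13 of FILE 50's `GluedLetters` ON THE TORUS OF RECORD, `δ, D` free of `s`, of the volume `m_T`, of `K`, of `r`: FILE 83's two-grid engine with the TRUE overlap `(L+1)^{d+1}`, programme P's
cut rows, LIFTED sandwiched entry-2 rows (P-IIj's transplant) at both spacings, the cut-cube defect (P-IIc) and the lifted entry-2 defect (P-IIj = N-IIg lifted), FILE 67's letters and the two-grid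
fits of `h_k`, `h_k∘e_ν`, `∇h_k`.

HONEST FRAMING ∕ LIMITS.  Block-majorant bookkeeping over LANDED rows; `U ≡ 1` MODEL of [B6] §2's machine on the torus of record (cube letters from each cube's own doubled torus via programme
P: not circular in the volume); constants crude and ours; nothing of [B5]∕[B6] (2.38)–(2.40)∕[B9] Thm 3.1, 3.14 asserted.  NE2⁺ NOT PRINTED, NOT proved; N15 NOT discharged; counts of record
UNMOVED (typed 28∕28 · discharged 5∕27); one finite 𝕋⁴ at fixed ε per index — NOT infinite volume, NOT OS on ℝ⁴, NOT a mass gap, NOT Clay; R4 closes `BalabanLadder.UV` only.  Restate-immune.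
-/

noncomputable section

namespace Summit.QuantumFields.YangMills.BalabanUVNodes.N15.Gluing

open Real
open Literature.MathematicalPhysics.QuantumFieldTheory.Balaban1983to89
open Literature.MathematicalPhysics.QuantumFieldTheory.Balaban1983to89.B5Prop11Plancherel (Tor fine unitVec)
open Literature.MathematicalPhysics.QuantumFieldTheory.Balaban1983to89.B11SectG (BlockNorm HasMaj RowSum)
open Literature.MathematicalPhysics.QuantumFieldTheory.Balaban1983to89.T4EtaRateDefect (idef)
open Literature.MathematicalPhysics.QuantumFieldTheory.Balaban1983to89.T4EtaRateCoeffDefect (pull)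
open Literature.MathematicalPhysics.QuantumFieldTheory.Balaban1983to89.B6Prop26Gluing (mulOp mulOp_apply ind ind_nonneg ind_le_one)
open Literature.MathematicalPhysics.QuantumFieldTheory.Balaban1983to89.B6Prop26ReachTransplant (transplant)
open Literature.MathematicalPhysics.QuantumFieldTheory.Balaban1983to89.B6UnitTorusCarrier (unitTorusGeo)
open Literature.MathematicalPhysics.QuantumFieldTheory.Balaban1983to89.B5SiteBridgeP12 (MP)
open Literature.MathematicalPhysics.QuantumFieldTheory.King1986.Torus (blockOf tdistT tdistT_nonneg)
open Summit.QuantumFields.YangMills.BalabanUVNodes.N15.VectorPiece (bshiftEquiv kingPrV blkFine)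
open Summit.QuantumFields.YangMills.BalabanUVNodes.N15.BackgroundLayer (fgrad fgradAdj mulOp_comp_fgradAdj symbOp_sTinv_sub_one_eq)
open Summit.QuantumFields.YangMills.BalabanUVNodes.N15.TwoGrid (paramsOf gOp symOp symbOp sTinv chiCube cubeBlocks cubeW liftCubeG MP_dvd_MP torRed redBond mem_cubeW
  hasMaj_chiCube_liftCubeG hasMaj_chiCube_liftCubeG_fine chiCube_liftCubeG_comp_divAdj_mulOp hasMaj_transplant_gDivAdj_pair hasMaj_idef_chiCube_liftCubeG hasMaj_idef_transplant_gDivAdj)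

variable {d : ℕ}

section TwoGrid

variable {L : ℕ} [NeZero L]

/-- ★★★ **THE TWO-GRID η-DEFECT OF THE «G∇*» ENTRY OF THE RECORD COVER's PARAMETRIX, VOLUME FREE** — the record twin of FILE 90: for `d ≥ 1`, odd `L ≥ 3`, `a > 0` there are `δ, D > 0`
such that for all `s`, `m_T ≥ s + 1`, `K ≥ 1` (`4 ≤ L^K`), `r`, `ν`, on `MP (paramsOf d L m_T K hL)` with FILE 73's cover at the spacings `L^{−K}` ⊃ `L^{−(K+r)}` (King's pairing),
`𝔇(G̃′∘∇*′_ν, G̃∘∇*_ν) ≤ D·(L^K)^{−1∕(8(d+1))}·e^{−δ|y−y′|_T}` — FILE 83 `hasMaj_idef_parametrix_comp_cut` with programme P's cut rows and lifted sandwiched entry-2 rows at both spacings (sandwich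
identities = P-IIj `chiCube_liftCubeG_comp_divAdj_mulOp` behind FILE 89's shifted-partition support), P-IIc's cut-cube defect, P-IIj's lifted entry-2 defect, `|h| ≤ 1`, `|∇h| ≤ π∕L^s`, the
two-grid fits, the TRUE overlap `(L+1)^{d+1}`; every `1∕L^s` bounded by `1`, `(L^K)^{−1∕16} ≤ (L^K)^{−1∕(8(d+1))}` for `d ≥ 1` (FILE 90 `entryTwoDefectConst_le`). [cite: Balaban1984PropagatorsII,
(2.91)–(2.93) p.239, (2.133)–(2.136) p.247 (shapes + mechanism); Balaban1985BackgroundPropagators, Thm 3.14 pp.426–427 (difference template); King1986, Prop. 3.9 (3.73) p.665 (rate factor)] -/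
theorem hasMaj_idef_parametrix_divAdj_knitR (hd1 : 1 ≤ d) (hL : Odd L ∧ 1 < L) {a : ℝ} (ha : 0 < a) :
    ∃ δ D : ℝ, 0 < δ ∧ 0 < D ∧ ∀ (s mT K r : ℕ) (hs : s + 1 ≤ mT) (_hK : 1 ≤ K) (_hn4 : 4 ≤ L ^ K) (ν : Fin (d + 1)),
      HasMaj (BlockNorm.ofBlocks (unitTorusGeo L K (MP (paramsOf d L mT K hL)))
          (fun b : Tor (fine (L ^ K) (MP (paramsOf d L mT K hL))) × Fin (d + 1) => blockOf (L ^ K) (MP (paramsOf d L mT K hL)) b.1))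
        (BlockNorm.ofBlocks (unitTorusGeo L K (MP (paramsOf d L mT K hL)))
          (fun i : Tor (fine (L ^ r * L ^ K) (MP (paramsOf d L mT K hL))) × Fin (d + 1) => blockOf (L ^ r * L ^ K) (MP (paramsOf d L mT K hL)) i.1))
        (idef (pull (kingPrV L K r (MP (paramsOf d L mT K hL)))) (pull (kingPrV L K r (MP (paramsOf d L mT K hL))))
          (parametrix (knitHR d L s mT K (L ^ r * L ^ K) hL) (knitGR d L s mT K (L ^ r * L ^ K) hL hs a) ∘ₗ
            fgradAdj ((L ^ r * L ^ K : ℕ) : ℝ) (bshiftEquiv (MP (paramsOf d L mT K hL)) (L ^ r * L ^ K) ν))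
          (parametrix (knitHR d L s mT K (L ^ K) hL) (knitGR d L s mT K (L ^ K) hL hs a) ∘ₗ fgradAdj ((L ^ K : ℕ) : ℝ) (bshiftEquiv (MP (paramsOf d L mT K hL)) (L ^ K) ν)))
        (fun y y' => D * ((L ^ K : ℕ) : ℝ) ^ (-(1 / (8 * ((d : ℝ) + 1)))) * Real.exp (-(δ * tdistT (MP (paramsOf d L mT K hL)) y y'))) := by
  have hL3 : 3 ≤ L := by obtain ⟨⟨j, hj⟩, h1⟩ := hL; omega
  have hLpos : 0 < L := by omega
  have hL1 : 1 ≤ L := hLpos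
  have hLodd : Odd L := hL.1
  have hL2 : 2 ≤ L := hL.2
  obtain ⟨δ₀, C, hδ₀, hC, HG⟩ := hasMaj_chiCube_liftCubeG (d := d) hL ha
  obtain ⟨δ₀', C', hδ₀', hC', HG'⟩ := hasMaj_chiCube_liftCubeG_fine (d := d) hL ha
  obtain ⟨δT, βT, hδT, hβT, HT⟩ := hasMaj_transplant_gDivAdj_pair (d := d) hL ha
  obtain ⟨δc, mc, hδc, hmc, HC⟩ := hasMaj_idef_chiCube_liftCubeG (d := d) hLodd hL2 ha (γ := 1 / 8) (by norm_num) (by norm_num)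
  obtain ⟨δ2, m2, hδ2, hm2, H2⟩ := hasMaj_idef_transplant_gDivAdj (d := d) hLodd hL2 ha
  set δ : ℝ := min (min (min δ₀ δ₀') δT) (min δc δ2) with hδ_def
  have hδ : 0 < δ := lt_min (lt_min (lt_min hδ₀ hδ₀') hδT) (lt_min hδc hδ2)
  have hd0 : δ ≤ δ₀ := (min_le_left _ _).trans ((min_le_left _ _).trans (min_le_left _ _))
  have hd0' : δ ≤ δ₀' := (min_le_left _ _).trans ((min_le_left _ _).trans (min_le_right _ _))
  have hdT : δ ≤ δT := (min_le_left _ _).trans (min_le_right _ _)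
  have hdc : δ ≤ δc := (min_le_right _ _).trans (min_le_left _ _)
  have hd2 : δ ≤ δ2 := (min_le_right _ _).trans (min_le_right _ _)
  set β : ℝ := C + C' with hβ_def
  have hβ : 0 ≤ β := by positivity
  have hCβ : C ≤ β := by rw [hβ_def]; linarith [hC'.le]
  have hCβ' : C' ≤ β := by rw [hβ_def]; linarith [hC.le]
  set Nov : ℝ := (((L + 1) ^ (d + 1) : ℕ) : ℝ) with hNov_def
  set Ko : ℝ := π * (d + 1) with hKo_def
  set Kos : ℝ := π * (d + 1) + π + π with hKos_def
  set Kod : ℝ := 64 * π ^ 2 + π ^ 2 * (d + 1 : ℕ) with hKod_def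
  set D : ℝ := Nov * ((βT * Kos + m2 + Ko * βT) + (β * Kod + mc * π + Ko * β * π)) + 1 with hD_def
  refine ⟨δ, D, hδ, by positivity, fun s mT K r hs hK hn4 ν => ?_⟩
  set M : Fin (d + 1) → ℕ := MP (paramsOf d L mT K hL) with hMdef
  have hs' : s ≤ mT := by omega
  have hM : ∀ μ, M μ = 2 * L ^ (mT - s) * L ^ s := MP_eq_two_mul L s mT K hL hs'
  have hM2 : ∀ μ, MP (paramsOf d L (s + 1) K hL) μ = 2 * L ^ (s + 1) := fun μ => rfl
  have hw : 0 < L ^ s := pow_pos hLpos s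
  have hq : 0 < L ^ (mT - s) := pow_pos hLpos _
  have hn : 1 ≤ L ^ K := Nat.one_le_pow _ _ hLpos
  have hn' : 1 ≤ L ^ r * L ^ K := Nat.one_le_iff_ne_zero.mpr (Nat.mul_ne_zero (pow_ne_zero r (NeZero.ne L)) (pow_ne_zero K (NeZero.ne L)))
  have hfit := coverMargin_fit hL3 s
  have hSe : L ^ (s + 1) = L * L ^ s := by rw [pow_succ, mul_comm]
  have hfit1 : coverMargin L s + 2 * L ^ s + 1 ≤ L ^ (s + 1) := by rw [hSe]; omega
  have hS : L ^ (s + 1) ≤ 2 * L ^ (mT - s) * L ^ s := by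
    calc L ^ (s + 1) ≤ L ^ mT := Nat.pow_le_pow_right hLpos hs
      _ = L ^ (mT - s) * L ^ s := by rw [← pow_add]; congr 1; omega
      _ ≤ 2 * L ^ (mT - s) * L ^ s := by rw [mul_assoc]; omega
  have hdiv : L ^ (s + 1) / L ^ s + 1 = L + 1 := by rw [hSe, Nat.mul_div_cancel _ hw]
  have h3 : 3 ≤ L ^ K * L ^ s :=
    calc 3 ≤ L := hL3
      _ = L ^ 1 := (pow_one L).symm
      _ ≤ L ^ K := Nat.pow_le_pow_right hLpos hK
      _ = L ^ K * 1 := (mul_one _).symm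
      _ ≤ L ^ K * L ^ s := Nat.mul_le_mul_left _ hw
  have hwR : (1 : ℝ) ≤ ((L ^ s : ℕ) : ℝ) := by exact_mod_cast hw
  have hnR : (1 : ℝ) ≤ ((L ^ K : ℕ) : ℝ) := by exact_mod_cast hn
  have hnn' : ((L ^ K : ℕ) : ℝ) ≤ ((L ^ r * L ^ K : ℕ) : ℝ) := by exact_mod_cast Nat.le_mul_of_pos_left (L ^ K) (pow_pos hLpos r)
  set e16 : ℝ := ((L ^ K : ℕ) : ℝ) ^ (-(1 / 16 : ℝ)) with he16_def
  set ε : ℝ := ((L ^ K : ℕ) : ℝ) ^ (-(1 / (8 * ((d : ℝ) + 1)))) with hε_def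
  obtain ⟨hnε, hnwε, hw1, hε0⟩ := rpow_sixteenth_facts hnR hwR
  have hε2 : 0 ≤ ε := Real.rpow_nonneg (by positivity) _
  have hd1R : (1 : ℝ) ≤ d := by exact_mod_cast hd1
  have heε : e16 ≤ ε := by
    refine Real.rpow_le_rpow_of_exponent_le hnR ?_
    have hpos : (0 : ℝ) < 8 * ((d : ℝ) + 1) := by positivity
    rw [neg_le_neg_iff, div_le_div_iff₀ hpos (by norm_num : (0 : ℝ) < 16)]
    nlinarith
  have hexp16 : (-((1 : ℝ) / 8 / 2)) = -(1 / 16 : ℝ) := by norm_num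
  have hblk : (fun i : Tor (fine (L ^ r * L ^ K) M) × Fin (d + 1) => blockOf (L ^ r * L ^ K) M i.1) =
      (fun b : Tor (fine (L ^ K) M) × Fin (d + 1) => blockOf (L ^ K) M b.1) ∘ kingPrV L K r M := (VectorPiece.blkFine_comp_kingPrV (M := M) L K r).symm
  have hind : ∀ (k : Fin (d + 1) → ZMod (2 * L ^ (mT - s))) (y y' : Tor M),
      0 ≤ ind (g := unitTorusGeo L K M) ((cubeBlocks M (coverCorner M (L ^ s) (L ^ (mT - s)) (coverMargin L s) k) (L ^ (s + 1)) : Finset (Tor M)) : Set (Tor M)) y *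
        ind (g := unitTorusGeo L K M) ((cubeBlocks M (coverCorner M (L ^ s) (L ^ (mT - s)) (coverMargin L s) k) (L ^ (s + 1)) : Finset (Tor M)) : Set (Tor M)) y' :=
    fun k y y' => mul_nonneg (ind_nonneg _ _) (ind_nonneg _ _)
  -- cut rows at both spacings
  have hGc : ∀ k : Fin (d + 1) → ZMod (2 * L ^ (mT - s)),
      HasMaj (BlockNorm.ofBlocks (unitTorusGeo L K M) (fun b : Tor (fine (L ^ K) M) × Fin (d + 1) => blockOf (L ^ K) M b.1))
        (BlockNorm.ofBlocks (unitTorusGeo L K M) (fun b : Tor (fine (L ^ K) M) × Fin (d + 1) => blockOf (L ^ K) M b.1))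
        (mulOp (chiCube M (L ^ K) (coverCorner M (L ^ s) (L ^ (mT - s)) (coverMargin L s) k) (L ^ (s + 1))) ∘ₗ knitGR d L s mT K (L ^ K) hL hs a k)
        (fun y y' => ind ((cubeBlocks M (coverCorner M (L ^ s) (L ^ (mT - s)) (coverMargin L s) k) (L ^ (s + 1)) : Finset (Tor M)) : Set (Tor M)) y *
          ind ((cubeBlocks M (coverCorner M (L ^ s) (L ^ (mT - s)) (coverMargin L s) k) (L ^ (s + 1)) : Finset (Tor M)) : Set (Tor M)) y' * (β * Real.exp (-(δ * tdistT M y y')))) := fun k =>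
    (hasMaj_rate_le (hind k) hC.le hd0 (HG (s + 1) mT K hs hK (coverCorner M (L ^ s) (L ^ (mT - s)) (coverMargin L s) k))).mono fun y y' =>
      mul_le_mul_of_nonneg_left (mul_le_mul_of_nonneg_right hCβ (Real.exp_nonneg _)) (hind k y y')
  have hGc' : ∀ k : Fin (d + 1) → ZMod (2 * L ^ (mT - s)),
      HasMaj (BlockNorm.ofBlocks (unitTorusGeo L K M) ((fun b : Tor (fine (L ^ K) M) × Fin (d + 1) => blockOf (L ^ K) M b.1) ∘ kingPrV L K r M))
        (BlockNorm.ofBlocks (unitTorusGeo L K M) ((fun b : Tor (fine (L ^ K) M) × Fin (d + 1) => blockOf (L ^ K) M b.1) ∘ kingPrV L K r M))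
        (mulOp (chiCube M (L ^ r * L ^ K) (coverCorner M (L ^ s) (L ^ (mT - s)) (coverMargin L s) k) (L ^ (s + 1))) ∘ₗ knitGR d L s mT K (L ^ r * L ^ K) hL hs a k)
        (fun y y' => ind ((cubeBlocks M (coverCorner M (L ^ s) (L ^ (mT - s)) (coverMargin L s) k) (L ^ (s + 1)) : Finset (Tor M)) : Set (Tor M)) y *
          ind ((cubeBlocks M (coverCorner M (L ^ s) (L ^ (mT - s)) (coverMargin L s) k) (L ^ (s + 1)) : Finset (Tor M)) : Set (Tor M)) y' * (β * Real.exp (-(δ * tdistT M y y')))) := fun k => by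
    rw [← hblk]
    exact (hasMaj_rate_le (hind k) hC'.le hd0' (HG' (s + 1) mT K r hs hK (coverCorner M (L ^ s) (L ^ (mT - s)) (coverMargin L s) k))).mono fun y y' =>
      mul_le_mul_of_nonneg_left (mul_le_mul_of_nonneg_right hCβ' (Real.exp_nonneg _)) (hind k y y')
  -- sandwiched entry-2 rows at both spacings
  have hT2 : ∀ k : Fin (d + 1) → ZMod (2 * L ^ (mT - s)),
      HasMaj (BlockNorm.ofBlocks (unitTorusGeo L K M) (fun b : Tor (fine (L ^ K) M) × Fin (d + 1) => blockOf (L ^ K) M b.1))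
        (BlockNorm.ofBlocks (unitTorusGeo L K M) (fun b : Tor (fine (L ^ K) M) × Fin (d + 1) => blockOf (L ^ K) M b.1))
        (transplant (cubeW (L ^ K) (coverCorner M (L ^ s) (L ^ (mT - s)) (coverMargin L s) k) (L ^ (s + 1))) (redBond (L ^ K) (MP_dvd_MP hL hs K))
          (symOp (MP (paramsOf d L (s + 1) K hL)) (L ^ K) (torRed (MP_dvd_MP hL hs K) (coverCorner M (L ^ s) (L ^ (mT - s)) (coverMargin L s) k)) ∘ₗ
            (gOp (MP (paramsOf d L (s + 1) K hL)) (L ^ K) a ∘ₗ fgradAdj ((L ^ K : ℕ) : ℝ) (bshiftEquiv (MP (paramsOf d L (s + 1) K hL)) (L ^ K) ν)) ∘ₗ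
            mulOp (chiCube (MP (paramsOf d L (s + 1) K hL)) (L ^ K) (torRed (MP_dvd_MP hL hs K) (coverCorner M (L ^ s) (L ^ (mT - s)) (coverMargin L s) k)) (L ^ (s + 1)))))
        (fun y y' => ind ((cubeBlocks M (coverCorner M (L ^ s) (L ^ (mT - s)) (coverMargin L s) k) (L ^ (s + 1)) : Finset (Tor M)) : Set (Tor M)) y *
          ind ((cubeBlocks M (coverCorner M (L ^ s) (L ^ (mT - s)) (coverMargin L s) k) (L ^ (s + 1)) : Finset (Tor M)) : Set (Tor M)) y' * (βT * Real.exp (-(δ * tdistT M y y')))) := fun k => by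
    have h := (HT (s + 1) mT K r hs hK (coverCorner M (L ^ s) (L ^ (mT - s)) (coverMargin L s) k) ν).1
    rw [symbOp_sTinv_sub_one_eq] at h
    exact hasMaj_rate_le (hind k) hβT.le hdT h
  have hT2' : ∀ k : Fin (d + 1) → ZMod (2 * L ^ (mT - s)),
      HasMaj (BlockNorm.ofBlocks (unitTorusGeo L K M) ((fun b : Tor (fine (L ^ K) M) × Fin (d + 1) => blockOf (L ^ K) M b.1) ∘ kingPrV L K r M))
        (BlockNorm.ofBlocks (unitTorusGeo L K M) ((fun b : Tor (fine (L ^ K) M) × Fin (d + 1) => blockOf (L ^ K) M b.1) ∘ kingPrV L K r M))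
        (transplant (cubeW (L ^ r * L ^ K) (coverCorner M (L ^ s) (L ^ (mT - s)) (coverMargin L s) k) (L ^ (s + 1))) (redBond (L ^ r * L ^ K) (MP_dvd_MP hL hs K))
          (symOp (MP (paramsOf d L (s + 1) K hL)) (L ^ r * L ^ K) (torRed (MP_dvd_MP hL hs K) (coverCorner M (L ^ s) (L ^ (mT - s)) (coverMargin L s) k)) ∘ₗ
            (gOp (MP (paramsOf d L (s + 1) K hL)) (L ^ r * L ^ K) a ∘ₗ fgradAdj ((L ^ r * L ^ K : ℕ) : ℝ) (bshiftEquiv (MP (paramsOf d L (s + 1) K hL)) (L ^ r * L ^ K) ν)) ∘ₗ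
            mulOp (chiCube (MP (paramsOf d L (s + 1) K hL)) (L ^ r * L ^ K) (torRed (MP_dvd_MP hL hs K) (coverCorner M (L ^ s) (L ^ (mT - s)) (coverMargin L s) k)) (L ^ (s + 1)))))
        (fun y y' => ind ((cubeBlocks M (coverCorner M (L ^ s) (L ^ (mT - s)) (coverMargin L s) k) (L ^ (s + 1)) : Finset (Tor M)) : Set (Tor M)) y *
          ind ((cubeBlocks M (coverCorner M (L ^ s) (L ^ (mT - s)) (coverMargin L s) k) (L ^ (s + 1)) : Finset (Tor M)) : Set (Tor M)) y' * (βT * Real.exp (-(δ * tdistT M y y')))) := fun k => by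
    have h := (HT (s + 1) mT K r hs hK (coverCorner M (L ^ s) (L ^ (mT - s)) (coverMargin L s) k) ν).2
    rw [symbOp_sTinv_sub_one_eq] at h
    rw [← hblk]
    exact hasMaj_rate_le (hind k) hβT.le hdT h
  -- defects: cut (N-IIc) and entry 2 (N-IIg)
  have hIGc : ∀ k : Fin (d + 1) → ZMod (2 * L ^ (mT - s)),
      HasMaj (BlockNorm.ofBlocks (unitTorusGeo L K M) (fun b : Tor (fine (L ^ K) M) × Fin (d + 1) => blockOf (L ^ K) M b.1))
        (BlockNorm.ofBlocks (unitTorusGeo L K M) ((fun b : Tor (fine (L ^ K) M) × Fin (d + 1) => blockOf (L ^ K) M b.1) ∘ kingPrV L K r M))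
        (idef (pull (kingPrV L K r M)) (pull (kingPrV L K r M))
          (mulOp (chiCube M (L ^ r * L ^ K) (coverCorner M (L ^ s) (L ^ (mT - s)) (coverMargin L s) k) (L ^ (s + 1))) ∘ₗ knitGR d L s mT K (L ^ r * L ^ K) hL hs a k)
          (mulOp (chiCube M (L ^ K) (coverCorner M (L ^ s) (L ^ (mT - s)) (coverMargin L s) k) (L ^ (s + 1))) ∘ₗ knitGR d L s mT K (L ^ K) hL hs a k))
        (fun y y' => ind ((cubeBlocks M (coverCorner M (L ^ s) (L ^ (mT - s)) (coverMargin L s) k) (L ^ (s + 1)) : Finset (Tor M)) : Set (Tor M)) y *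
          ind ((cubeBlocks M (coverCorner M (L ^ s) (L ^ (mT - s)) (coverMargin L s) k) (L ^ (s + 1)) : Finset (Tor M)) : Set (Tor M)) y' * (mc * e16 * Real.exp (-(δ * tdistT M y y')))) := fun k => by
    have h := HC (s + 1) mT K r hK hL hs (coverCorner M (L ^ s) (L ^ (mT - s)) (coverMargin L s) k)
    rw [hexp16] at h
    have h2 := hasMaj_rate_le (hind k) (by positivity : 0 ≤ mc * e16) hdc h
    rw [hblk] at h2
    exact h2
  have hIT2 : ∀ k : Fin (d + 1) → ZMod (2 * L ^ (mT - s)),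
      HasMaj (BlockNorm.ofBlocks (unitTorusGeo L K M) (fun b : Tor (fine (L ^ K) M) × Fin (d + 1) => blockOf (L ^ K) M b.1))
        (BlockNorm.ofBlocks (unitTorusGeo L K M) ((fun b : Tor (fine (L ^ K) M) × Fin (d + 1) => blockOf (L ^ K) M b.1) ∘ kingPrV L K r M))
        (idef (pull (kingPrV L K r M)) (pull (kingPrV L K r M))
          (transplant (cubeW (L ^ r * L ^ K) (coverCorner M (L ^ s) (L ^ (mT - s)) (coverMargin L s) k) (L ^ (s + 1))) (redBond (L ^ r * L ^ K) (MP_dvd_MP hL hs K))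
          (symOp (MP (paramsOf d L (s + 1) K hL)) (L ^ r * L ^ K) (torRed (MP_dvd_MP hL hs K) (coverCorner M (L ^ s) (L ^ (mT - s)) (coverMargin L s) k)) ∘ₗ
            (gOp (MP (paramsOf d L (s + 1) K hL)) (L ^ r * L ^ K) a ∘ₗ fgradAdj ((L ^ r * L ^ K : ℕ) : ℝ) (bshiftEquiv (MP (paramsOf d L (s + 1) K hL)) (L ^ r * L ^ K) ν)) ∘ₗ
            mulOp (chiCube (MP (paramsOf d L (s + 1) K hL)) (L ^ r * L ^ K) (torRed (MP_dvd_MP hL hs K) (coverCorner M (L ^ s) (L ^ (mT - s)) (coverMargin L s) k)) (L ^ (s + 1)))))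
          (transplant (cubeW (L ^ K) (coverCorner M (L ^ s) (L ^ (mT - s)) (coverMargin L s) k) (L ^ (s + 1))) (redBond (L ^ K) (MP_dvd_MP hL hs K))
          (symOp (MP (paramsOf d L (s + 1) K hL)) (L ^ K) (torRed (MP_dvd_MP hL hs K) (coverCorner M (L ^ s) (L ^ (mT - s)) (coverMargin L s) k)) ∘ₗ
            (gOp (MP (paramsOf d L (s + 1) K hL)) (L ^ K) a ∘ₗ fgradAdj ((L ^ K : ℕ) : ℝ) (bshiftEquiv (MP (paramsOf d L (s + 1) K hL)) (L ^ K) ν)) ∘ₗ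
            mulOp (chiCube (MP (paramsOf d L (s + 1) K hL)) (L ^ K) (torRed (MP_dvd_MP hL hs K) (coverCorner M (L ^ s) (L ^ (mT - s)) (coverMargin L s) k)) (L ^ (s + 1))))))
        (fun y y' => ind ((cubeBlocks M (coverCorner M (L ^ s) (L ^ (mT - s)) (coverMargin L s) k) (L ^ (s + 1)) : Finset (Tor M)) : Set (Tor M)) y *
          ind ((cubeBlocks M (coverCorner M (L ^ s) (L ^ (mT - s)) (coverMargin L s) k) (L ^ (s + 1)) : Finset (Tor M)) : Set (Tor M)) y' * (m2 * ε * Real.exp (-(δ * tdistT M y y')))) := fun k => by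
    have h := H2 (s + 1) mT K r hK hn4 hL hs (coverCorner M (L ^ s) (L ^ (mT - s)) (coverMargin L s) k) ν
    rw [symbOp_sTinv_sub_one_eq, symbOp_sTinv_sub_one_eq] at h
    have h2 := hasMaj_rate_le (hind k) (by positivity : 0 ≤ m2 * ε) hd2 h
    rw [hblk] at h2
    exact h2
  -- the partition: Leibniz, cuts, sandwiched identities, sizes, fits, overlap
  have hχ := fun μ k => chiCube_coverCorner_eq_one_side (M := M) (n := L ^ K) (m₀ := coverMargin L s) hM hw hfit1 hS μ k
  have hχ' := fun μ k => chiCube_coverCorner_eq_one_side (M := M) (n := L ^ r * L ^ K) (m₀ := coverMargin L s) hM hw hfit1 hS μ k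
  have hleib : ∀ k : Fin (d + 1) → ZMod (2 * L ^ (mT - s)), mulOp (knitHR d L s mT K (L ^ K) hL k) ∘ₗ fgradAdj ((L ^ K : ℕ) : ℝ) (bshiftEquiv M (L ^ K) ν) =
      fgradAdj ((L ^ K : ℕ) : ℝ) (bshiftEquiv M (L ^ K) ν) ∘ₗ mulOp (knitHR d L s mT K (L ^ K) hL k ∘ ⇑(bshiftEquiv M (L ^ K) ν)) +
        mulOp (fgrad ((L ^ K : ℕ) : ℝ) (bshiftEquiv M (L ^ K) ν) (knitHR d L s mT K (L ^ K) hL k)) := fun k => mulOp_comp_fgradAdj _ _ _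
  have hleib' : ∀ k : Fin (d + 1) → ZMod (2 * L ^ (mT - s)), mulOp (knitHR d L s mT K (L ^ r * L ^ K) hL k) ∘ₗ fgradAdj ((L ^ r * L ^ K : ℕ) : ℝ) (bshiftEquiv M (L ^ r * L ^ K) ν) =
      fgradAdj ((L ^ r * L ^ K : ℕ) : ℝ) (bshiftEquiv M (L ^ r * L ^ K) ν) ∘ₗ mulOp (knitHR d L s mT K (L ^ r * L ^ K) hL k ∘ ⇑(bshiftEquiv M (L ^ r * L ^ K) ν)) +
        mulOp (fgrad ((L ^ r * L ^ K : ℕ) : ℝ) (bshiftEquiv M (L ^ r * L ^ K) ν) (knitHR d L s mT K (L ^ r * L ^ K) hL k)) := fun k => mulOp_comp_fgradAdj _ _ _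
  have hcut : ∀ k : Fin (d + 1) → ZMod (2 * L ^ (mT - s)), mulOp (knitHR d L s mT K (L ^ K) hL k) ∘ₗ mulOp (chiCube M (L ^ K) (coverCorner M (L ^ s) (L ^ (mT - s)) (coverMargin L s) k) (L ^ (s + 1))) =
      mulOp (knitHR d L s mT K (L ^ K) hL k) := fun k => hcube_cut (2 * L ^ (mT - s)) (coverXi M (L ^ K) (L ^ s)) (bshiftEquiv M (L ^ K)) 0 (hχ 0 k)
  have hcut' : ∀ k : Fin (d + 1) → ZMod (2 * L ^ (mT - s)), mulOp (knitHR d L s mT K (L ^ r * L ^ K) hL k) ∘ₗ mulOp (chiCube M (L ^ r * L ^ K) (coverCorner M (L ^ s) (L ^ (mT - s)) (coverMargin L s) k) (L ^ (s + 1))) =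
      mulOp (knitHR d L s mT K (L ^ r * L ^ K) hL k) := fun k => hcube_cut (2 * L ^ (mT - s)) (coverXi M (L ^ r * L ^ K) (L ^ s)) (bshiftEquiv M (L ^ r * L ^ K)) 0 (hχ' 0 k)
  have hgS : ∀ (n : ℕ) [NeZero n] (k : Fin (d + 1) → ZMod (2 * L ^ (mT - s))) (b : Tor (fine n M) × Fin (d + 1)),
      (knitHR d L s mT K n hL k ∘ ⇑(bshiftEquiv M n ν)) b ≠ 0 →
      b ∈ cubeW n (coverCorner M (L ^ s) (L ^ (mT - s)) (coverMargin L s) k) (L ^ (s + 1)) ∧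
        (b.1 + unitVec (fine n M) ν, b.2) ∈ cubeW n (coverCorner M (L ^ s) (L ^ (mT - s)) (coverMargin L s) k) (L ^ (s + 1)) := fun n _ k b hb => by
    have h := coverH_shift_support (m₀ := coverMargin L s) hM hw hfit1 hS ν k b hb
    exact ⟨(mem_cubeW b).mpr h.1, (mem_cubeW _).mpr h.2⟩
  have hE2 : ∀ k : Fin (d + 1) → ZMod (2 * L ^ (mT - s)),
      mulOp (chiCube M (L ^ K) (coverCorner M (L ^ s) (L ^ (mT - s)) (coverMargin L s) k) (L ^ (s + 1))) ∘ₗ knitGR d L s mT K (L ^ K) hL hs a k ∘ₗ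
          fgradAdj ((L ^ K : ℕ) : ℝ) (bshiftEquiv M (L ^ K) ν) ∘ₗ mulOp (knitHR d L s mT K (L ^ K) hL k ∘ ⇑(bshiftEquiv M (L ^ K) ν)) =
        (transplant (cubeW (L ^ K) (coverCorner M (L ^ s) (L ^ (mT - s)) (coverMargin L s) k) (L ^ (s + 1))) (redBond (L ^ K) (MP_dvd_MP hL hs K))
          (symOp (MP (paramsOf d L (s + 1) K hL)) (L ^ K) (torRed (MP_dvd_MP hL hs K) (coverCorner M (L ^ s) (L ^ (mT - s)) (coverMargin L s) k)) ∘ₗ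
            (gOp (MP (paramsOf d L (s + 1) K hL)) (L ^ K) a ∘ₗ fgradAdj ((L ^ K : ℕ) : ℝ) (bshiftEquiv (MP (paramsOf d L (s + 1) K hL)) (L ^ K) ν)) ∘ₗ
            mulOp (chiCube (MP (paramsOf d L (s + 1) K hL)) (L ^ K) (torRed (MP_dvd_MP hL hs K) (coverCorner M (L ^ s) (L ^ (mT - s)) (coverMargin L s) k)) (L ^ (s + 1))))) ∘ₗ
          mulOp (knitHR d L s mT K (L ^ K) hL k ∘ ⇑(bshiftEquiv M (L ^ K) ν)) := fun k => by
    have h := chiCube_liftCubeG_comp_divAdj_mulOp (L ^ K) (MP_dvd_MP hL hs K) (coverCorner M (L ^ s) (L ^ (mT - s)) (coverMargin L s) k) (L ^ (s + 1)) hM2 hn ha ν (hgS (L ^ K) k)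
    rw [symbOp_sTinv_sub_one_eq, symbOp_sTinv_sub_one_eq] at h
    exact h
  have hE2' : ∀ k : Fin (d + 1) → ZMod (2 * L ^ (mT - s)),
      mulOp (chiCube M (L ^ r * L ^ K) (coverCorner M (L ^ s) (L ^ (mT - s)) (coverMargin L s) k) (L ^ (s + 1))) ∘ₗ knitGR d L s mT K (L ^ r * L ^ K) hL hs a k ∘ₗ
          fgradAdj ((L ^ r * L ^ K : ℕ) : ℝ) (bshiftEquiv M (L ^ r * L ^ K) ν) ∘ₗ mulOp (knitHR d L s mT K (L ^ r * L ^ K) hL k ∘ ⇑(bshiftEquiv M (L ^ r * L ^ K) ν)) =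
        (transplant (cubeW (L ^ r * L ^ K) (coverCorner M (L ^ s) (L ^ (mT - s)) (coverMargin L s) k) (L ^ (s + 1))) (redBond (L ^ r * L ^ K) (MP_dvd_MP hL hs K))
          (symOp (MP (paramsOf d L (s + 1) K hL)) (L ^ r * L ^ K) (torRed (MP_dvd_MP hL hs K) (coverCorner M (L ^ s) (L ^ (mT - s)) (coverMargin L s) k)) ∘ₗ
            (gOp (MP (paramsOf d L (s + 1) K hL)) (L ^ r * L ^ K) a ∘ₗ fgradAdj ((L ^ r * L ^ K : ℕ) : ℝ) (bshiftEquiv (MP (paramsOf d L (s + 1) K hL)) (L ^ r * L ^ K) ν)) ∘ₗ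
            mulOp (chiCube (MP (paramsOf d L (s + 1) K hL)) (L ^ r * L ^ K) (torRed (MP_dvd_MP hL hs K) (coverCorner M (L ^ s) (L ^ (mT - s)) (coverMargin L s) k)) (L ^ (s + 1))))) ∘ₗ
          mulOp (knitHR d L s mT K (L ^ r * L ^ K) hL k ∘ ⇑(bshiftEquiv M (L ^ r * L ^ K) ν)) := fun k => by
    have h := chiCube_liftCubeG_comp_divAdj_mulOp (L ^ r * L ^ K) (MP_dvd_MP hL hs K) (coverCorner M (L ^ s) (L ^ (mT - s)) (coverMargin L s) k) (L ^ (s + 1)) hM2 hn' ha ν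
      (hgS (L ^ r * L ^ K) k)
    rw [symbOp_sTinv_sub_one_eq, symbOp_sTinv_sub_one_eq] at h
    exact h
  have hh' : ∀ (k : Fin (d + 1) → ZMod (2 * L ^ (mT - s))) x', |knitHR d L s mT K (L ^ r * L ^ K) hL k x'| ≤ 1 := fun k x' => abs_coverH_le_one k x'
  have hhs : ∀ (k : Fin (d + 1) → ZMod (2 * L ^ (mT - s))) x, |(knitHR d L s mT K (L ^ K) hL k ∘ ⇑(bshiftEquiv M (L ^ K) ν)) x| ≤ 1 := fun k x => abs_coverH_le_one k (bshiftEquiv M (L ^ K) ν x)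
  have hdh : ∀ (k : Fin (d + 1) → ZMod (2 * L ^ (mT - s))) x, |fgrad ((L ^ K : ℕ) : ℝ) (bshiftEquiv M (L ^ K) ν) (knitHR d L s mT K (L ^ K) hL k) x| ≤ π / ((L ^ s : ℕ) : ℝ) :=
    fun k x => abs_fgrad_coverH_le hM hw k ν x
  have hfitH : ∀ (k : Fin (d + 1) → ZMod (2 * L ^ (mT - s))) x', |knitHR d L s mT K (L ^ r * L ^ K) hL k x' - knitHR d L s mT K (L ^ K) hL k (kingPrV L K r M x')| ≤
      π * (d + 1) / (((L ^ K : ℕ) : ℝ) * ((L ^ s : ℕ) : ℝ)) := fun k x' => abs_coverH_fine_sub_le (L := L) (kk := K) (r := r) hM hw k x'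
  have hfits : ∀ (k : Fin (d + 1) → ZMod (2 * L ^ (mT - s))) x', |(knitHR d L s mT K (L ^ r * L ^ K) hL k ∘ ⇑(bshiftEquiv M (L ^ r * L ^ K) ν)) x' -
      (knitHR d L s mT K (L ^ K) hL k ∘ ⇑(bshiftEquiv M (L ^ K) ν)) (kingPrV L K r M x')| ≤
      π * (d + 1) / (((L ^ K : ℕ) : ℝ) * ((L ^ s : ℕ) : ℝ)) + π / ((L ^ s : ℕ) : ℝ) / ((L ^ r * L ^ K : ℕ) : ℝ) + π / ((L ^ s : ℕ) : ℝ) / ((L ^ K : ℕ) : ℝ) :=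
    fun k x' => abs_coverH_shift_fine_sub_le (L := L) (kk := K) (r := r) hM hw k ν x'
  obtain ⟨hs0, hs13, hs1', hs1, hsL, hnκ, hnκ'⟩ := coverFit_params (L := L) (kk := K) (r := r) (w := L ^ s) hL1 hw h3
  have hξ := fun μ μ' b => coverXi_shift (n := L ^ K) hM hw μ μ' b
  have hξ' := fun μ μ' b => coverXi_shift (n := L ^ r * L ^ K) hM hw μ μ' b
  have hoff := fun μ x' => coverXi_offset (M := M) (L := L) (kk := K) (r := r) (w := L ^ s) (q := L ^ (mT - s)) μ x'
  have hK2 : 2 ≤ 2 * L ^ (mT - s) := by omega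
  have hLr : 1 ≤ L ^ r := Nat.one_le_pow _ _ hLpos
  have hfitd : ∀ (k : Fin (d + 1) → ZMod (2 * L ^ (mT - s))) x', |fgrad ((L ^ r * L ^ K : ℕ) : ℝ) (bshiftEquiv M (L ^ r * L ^ K) ν) (knitHR d L s mT K (L ^ r * L ^ K) hL k) x' -
      fgrad ((L ^ K : ℕ) : ℝ) (bshiftEquiv M (L ^ K) ν) (knitHR d L s mT K (L ^ K) hL k) (kingPrV L K r M x')| ≤
      |((((L ^ s : ℕ) : ℝ)))⁻¹| * (((L ^ K : ℕ) : ℝ) * ((L ^ s : ℕ) : ℝ))⁻¹ * (64 * π ^ 2 + π ^ 2 * Fintype.card (Fin (d + 1))) := fun k x' =>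
    abs_fgrad_hcube_two_grid_le (2 * L ^ (mT - s)) (coverXi M (L ^ K) (L ^ s)) (coverXi M (L ^ r * L ^ K) (L ^ s)) (kingPrV L K r M) (bshiftEquiv M (L ^ K))
      (bshiftEquiv M (L ^ r * L ^ K)) hK2 hLr hs0 hs1' hsL hnκ hnκ' hξ hξ' hoff k ν x'
  have hN : ∀ y : Tor M, ∑ k : Fin (d + 1) → ZMod (2 * L ^ (mT - s)),
      ind (g := unitTorusGeo L K M) ((cubeBlocks M (coverCorner M (L ^ s) (L ^ (mT - s)) (coverMargin L s) k) (L ^ (s + 1)) : Finset _) : Set _) y ≤ Nov := fun y => by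
    have h := sum_ind_cubeBlocks_le_overlap (S := L ^ (s + 1)) (m₀ := coverMargin L s) hM hw L K y
    rw [hdiv] at h
    exact h
  -- FILE 83
  have key := hasMaj_idef_parametrix_comp_cut (g := unitTorusGeo L K M) (fun b : Tor (fine (L ^ K) M) × Fin (d + 1) => blockOf (L ^ K) M b.1) (kingPrV L K r M)
    (fun k => ((cubeBlocks M (coverCorner M (L ^ s) (L ^ (mT - s)) (coverMargin L s) k) (L ^ (s + 1)) : Finset (Tor M)) : Set (Tor M)))
    (E := fgradAdj ((L ^ K : ℕ) : ℝ) (bshiftEquiv M (L ^ K) ν)) (E' := fgradAdj ((L ^ r * L ^ K : ℕ) : ℝ) (bshiftEquiv M (L ^ r * L ^ K) ν))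
    (G := knitGR d L s mT K (L ^ K) hL hs a) (G' := knitGR d L s mT K (L ^ r * L ^ K) hL hs a)
    hβ hβT.le zero_le_one (by positivity : (0 : ℝ) ≤ π / ((L ^ s : ℕ) : ℝ)) (by positivity) (by positivity) (by positivity) (by positivity : 0 ≤ mc * e16)
    (by positivity : 0 ≤ m2 * ε) hleib hleib' hcut hcut' hE2 hE2' hh' hhs hdh hfitH hfits hfitd hN hGc hGc' hT2 hT2' hIGc hIT2
  rw [← hblk] at key
  refine key.mono fun y y' => mul_le_mul_of_nonneg_right ?_ (Real.exp_nonneg _)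
  -- the compression
  clear key hIT2 hIGc hT2' hT2 hGc' hGc hleib hleib' hcut hcut' hE2 hE2' hgS hh' hhs hdh hfitH hfits hfitd hN hξ hξ' hoff hχ hχ' HG HG' HT HC H2 hblk hind
  rw [Fintype.card_fin]
  have hwpos : (0 : ℝ) < ((L ^ s : ℕ) : ℝ) := by linarith
  have hnpos : (0 : ℝ) < ((L ^ K : ℕ) : ℝ) := by linarith
  have hcdπ : π / ((L ^ s : ℕ) : ℝ) ≤ π := div_le_self Real.pi_pos.le hwR
  have ho : π * (d + 1) / (((L ^ K : ℕ) : ℝ) * ((L ^ s : ℕ) : ℝ)) ≤ Ko * e16 := by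
    rw [div_eq_mul_inv]; exact mul_le_mul_of_nonneg_left hnwε (by positivity)
  have hπw : π / ((L ^ s : ℕ) : ℝ) / ((L ^ K : ℕ) : ℝ) ≤ π * e16 := by
    rw [div_div, div_eq_mul_inv, mul_comm ((L ^ s : ℕ) : ℝ)]
    exact mul_le_mul_of_nonneg_left hnwε Real.pi_pos.le
  have hπw' : π / ((L ^ s : ℕ) : ℝ) / ((L ^ r * L ^ K : ℕ) : ℝ) ≤ π * e16 :=
    le_trans (div_le_div_of_nonneg_left (by positivity) hnpos hnn') hπw
  have hos : π * (d + 1) / (((L ^ K : ℕ) : ℝ) * ((L ^ s : ℕ) : ℝ)) + π / ((L ^ s : ℕ) : ℝ) / ((L ^ r * L ^ K : ℕ) : ℝ) + π / ((L ^ s : ℕ) : ℝ) / ((L ^ K : ℕ) : ℝ) ≤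
      Kos * e16 := by
    calc _ ≤ Ko * e16 + π * e16 + π * e16 := add_le_add (add_le_add ho hπw') hπw
      _ = Kos * e16 := by rw [hKos_def, hKo_def]; ring
  have hod : |((((L ^ s : ℕ) : ℝ)))⁻¹| * (((L ^ K : ℕ) : ℝ) * ((L ^ s : ℕ) : ℝ))⁻¹ * (64 * π ^ 2 + π ^ 2 * (d + 1 : ℕ)) ≤ Kod * e16 := by
    rw [abs_of_pos (inv_pos.mpr hwpos)]
    have t : (((L ^ s : ℕ) : ℝ))⁻¹ * (((L ^ K : ℕ) : ℝ) * ((L ^ s : ℕ) : ℝ))⁻¹ ≤ 1 * e16 := mul_le_mul hw1 hnwε (by positivity) zero_le_one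
    rw [one_mul] at t
    calc (((L ^ s : ℕ) : ℝ))⁻¹ * (((L ^ K : ℕ) : ℝ) * ((L ^ s : ℕ) : ℝ))⁻¹ * (64 * π ^ 2 + π ^ 2 * (d + 1 : ℕ))
        ≤ e16 * (64 * π ^ 2 + π ^ 2 * (d + 1 : ℕ)) := mul_le_mul_of_nonneg_right t (by positivity)
      _ = Kod * e16 := by rw [hKod_def]; ring
  have hcomp := entryTwoDefectConst_le (m₂ := m2) (by positivity : 0 ≤ Nov) hβ hβT.le (by positivity : (0 : ℝ) ≤ π / ((L ^ s : ℕ) : ℝ)) hcdπ hmc.le hε0 heε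
    (by positivity) (by positivity) (by positivity) ho hos hod
  refine hcomp.trans ?_
  rw [hD_def, add_mul _ (1 : ℝ) ε, one_mul]
  exact le_add_of_nonneg_right hε2

end TwoGrid

end Summit.QuantumFields.YangMills.BalabanUVNodes.N15.Gluing

end
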